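import Literature.AnabelianGeometry.EtaleTheta.Discharge.Sec3Thm37Units
import Literature.AnabelianGeometry.EtaleTheta.BiKummer

/-!
# [EtTh] Definition 4.1 (ii): «the natural injection `Aut_C(A)/O^×(A) ↪ Aut_D(A^bs)`» — kernel form, and `O^×(A)` normal and
# abelian in `Aut_C(A)` for the §4 bi-Kummer setting (proof-only)

S. Mochizuki, *The étale theta function and its Frobenioid-theoretic manifestations*, Publ. RIMS **45** (2009)
[MochizukiEtTh2009], §4, Def 4.1 (ii), PDF p.87 (printed p.313): «`H_A ⊆ Aut_C(A)/O^×(A)` for the inverse image of `H_A^{bs}`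
via the natural injection `Aut_C(A)/O^×(A) ↪ Aut_D(A^bs)`»; [FrdI] Def 1.2 (ii) p.22 (`O^×(A)` := base-identity linear
automorphisms) and Rmk 1.3.1 (`O^×(A)` abelian); [FrdII] Def 2.2 (i) p.17 («the natural action by conjugation of `Aut_C(A)` on
`O^×(A) (⊆ Aut_C(A))`»).

abc-iut cell, layer L2, seat abc-iut-w6-d047 (gen 2); prerequisite of the [FrdII] Def 2.2 context of an object of the hull
(HOME/staging/w6/w6-d047/g2/T44-L15b-EPART-SPEC.md §1: `actC` = conjugation on `O^×(A)`, `O := ↥O^×(A)` commutative).  PROOF-ONLY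
(0 `def`s, no instance, no named fact) over abc-iut-L2-t3's `BiKummerSetting.units` / `autBase` (`BiKummer.lean`) and abc-iut-w5-d164's
`TemperedFrobenioid.unitsSubgroup_toElem_eq_units` (`Discharge/Sec3Thm37Units.lean`) + L1's `ModelFrobenioid.isMulCommutative_units`:
* `TemperedFrobenioid.units_eq_ker_autBase` / `BiKummerSetting.units_eq_ker_autBase` — **`O^×(A) = Ker(Aut_C(A) → Aut_D(A^bs))`**:
  automorphisms of the model Frobenioid are linear, so «base-identity ∧ linear» = «base-identity»; this IS the injectivity of
  `Aut_C(A)/O^×(A) → Aut_D(A^bs)` that Def 4.1 (ii) calls «the natural injection»;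
* `…units_normal` — `O^×(A) ⊴ Aut_C(A)` (a kernel);
* `…units_mul_comm` — `O^×(A)` is abelian ([FrdI] Rmk 1.3.1 for the model: `ModelFrobenioidUnits`);
* `BiKummerSetting.units_le_HA` — `O^×(A) ⊆ H_A` (the preimage of `H_A^{bs}` contains the kernel), i.e. `H_A` «contains `O^×(A)`» as
  the typed `HA` docstring says.
HONEST FRAMING: elementary; refereed pre-IUT material; nothing here bears on [IUTchIII] Cor. 3.12; typed ≠ proved elsewhere.
-/

noncomputable section

namespace Literature.AnabelianGeometry.EtaleTheta

open CategoryTheory Opposite Literature.AlgebraicGeometry.Frobenioids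

universe u₀ v₀ u v w

namespace TemperedFrobenioid

variable {D₀ : Type u₀} [Category.{v₀} D₀] {V : FrdIMonoidStub.{w}} {T : RealifiedDivisorMonoids (D₀ := D₀) V}
  {D : Type u} [Category.{v} D] {VD : FrdICatStub.{u, v, w} D} (C : TemperedFrobenioid T D VD)

/-- **`O^×(A) = Ker(Aut_C(A) → Aut_D(A^bs))`** for the tempered Frobenioid ([FrdI] Def 1.2 (ii); every automorphism of the model
Frobenioid has Frobenius degree `1`, `PreFrobenioid.isLinear_of_isIso`). [cite: MochizukiEtTh2009, Def 4.1 (ii) p.87] -/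
theorem units_eq_ker_autBase (A : C.category) : C.units A = (C.baseFunctorOfCategory.mapAut A).ker := by
  ext α
  rw [MonoidHom.mem_ker]
  constructor
  · intro h
    exact Aut.ext h.1
  · intro h
    exact ⟨congrArg Iso.hom h, PreFrobenioid.isLinear_of_isIso C.toElem _⟩

/-- `O^×(A)` is normal in `Aut_C(A)` (it is a kernel). [cite: MochizukiFrdII2008, Def 2.2 (i) p.17] -/
theorem units_normal (A : C.category) : (C.units A).Normal := by
  rw [units_eq_ker_autBase]
  infer_instance

/-- **`O^×(A)` is abelian** ([FrdI] Rmk 1.3.1, for the model Frobenioid: abc-iut-L1's `ModelFrobenioid.isMulCommutative_units` read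
through `unitsSubgroup_toElem_eq_units`). [cite: MochizukiFrdI2008, Rmk. 1.3.1 p.27] -/
theorem units_mul_comm (A : C.category) {σ τ : Aut A} (hσ : σ ∈ C.units A) (hτ : τ ∈ C.units A) : σ * τ = τ * σ := by
  rw [show C.units A = PreFrobenioid.unitsSubgroup C.toElem A from rfl, C.unitsSubgroup_toElem_eq_units] at hσ hτ
  have h := (ModelFrobenioid.isMulCommutative_units A).is_comm.comm ⟨σ, hσ⟩ ⟨τ, hτ⟩
  exact congrArg Subtype.val h

end TemperedFrobenioid

namespace BiKummerSetting

variable {K : Type u₀} [Field K] {X : SemiGraphs.TemperedArithmeticGroup.{u₀} K} {D₀ : Type u₀} [Category.{v₀} D₀]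
  {V : FrdIMonoidStub.{w}} {T : RealifiedDivisorMonoids (D₀ := D₀) V} {D : Type u} [Category.{v} D]
  {VD : FrdICatStub.{u, v, w} D} (S : BiKummerSetting X T D VD)

/-- **Def 4.1 (ii), «the natural injection `Aut_C(A)/O^×(A) ↪ Aut_D(A^bs)`», kernel form**: `O^×(A) = Ker(autBase A)` — so the
homomorphism `Aut_C(A) → Aut_D(A^bs)` induced by `Base` factors through an INJECTION of `Aut_C(A)/O^×(A)`.
[cite: MochizukiEtTh2009, Def 4.1 (ii) p.87] -/
theorem units_eq_ker_autBase (A : S.C) : S.units A = (S.autBase A).ker :=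
  S.tf.units_eq_ker_autBase A

/-- `O^×(A) ⊴ Aut_C(A)`. [cite: MochizukiFrdII2008, Def 2.2 (i) p.17] -/
theorem units_normal (A : S.C) : (S.units A).Normal :=
  S.tf.units_normal A

/-- `O^×(A)` is abelian. [cite: MochizukiFrdI2008, Rmk. 1.3.1 p.27] -/
theorem units_mul_comm (A : S.C) {σ τ : Aut A} (hσ : σ ∈ S.units A) (hτ : τ ∈ S.units A) : σ * τ = τ * σ :=
  S.tf.units_mul_comm A hσ hτ

/-- **`O^×(A) ⊆ H_A`** (Def 4.1 (ii): `H_A` is the inverse image of `H_A^{bs}` under `Aut_C(A) → Aut_C(A)/O^×(A) ↪ Aut_D(A^bs)`, so it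
contains `O^×(A)` — the typed `HA` is the `comap` along `autBase`). [cite: MochizukiEtTh2009, Def 4.1 (ii) p.87] -/
theorem units_le_HA (A : S.C) (hA : S.IsGalois A) : S.units A ≤ S.HA A hA := by
  intro σ hσ
  rw [units_eq_ker_autBase, MonoidHom.mem_ker] at hσ
  show S.autBase A σ ∈ S.HAbs A hA
  rw [hσ]
  exact one_mem _

/-- The quotient map `Aut_C(A)/O^×(A) → Aut_D(A^bs)` induced by `Base` is INJECTIVE («the natural injection», Def 4.1 (ii)).
[cite: MochizukiEtTh2009, Def 4.1 (ii) p.87] -/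
theorem kerLift_autBase_injective (A : S.C) :
    Function.Injective (QuotientGroup.kerLift (S.autBase A)) :=
  QuotientGroup.kerLift_injective (S.autBase A)

end BiKummerSetting

end Literature.AnabelianGeometry.EtaleTheta

end

/-! ## v2 (append-only): `O^×` along an isomorphism of `C` — the `isoO` field of a [FrdII] Def 2.2 context isomorphism -/

namespace Literature.AnabelianGeometry.EtaleTheta

open CategoryTheory Literature.AlgebraicGeometry.Frobenioids

namespace TemperedFrobenioid

universe u₀' v₀' u' v' w'

variable {D₀ : Type u₀'} [Category.{v₀'} D₀] {V : FrdIMonoidStub.{w'}} {T : RealifiedDivisorMonoids (D₀ := D₀) V}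
  {D : Type u'} [Category.{v'} D] {VD : FrdICatStub.{u', v', w'} D} (C : TemperedFrobenioid T D VD)

/-- **`O^×(−)` is carried onto `O^×(−)` by conjugation along an isomorphism `e : Y ≅ Z` of `C`**: `e⁻¹ ∘ O^×(Y) ∘ e = O^×(Z)`
(`O^× = Ker(Aut_C → Aut_D)` and `Base` commutes with conjugation).  With `Ψ` on `Aut` this gives the `isoO` field of
the [FrdII] Def 2.2 context isomorphism for `B ≅ Ψ(A)`. [cite: MochizukiFrdII2008, Def 2.2 (i) p.17] -/
theorem units_map_conjAut {Y Z : C.category} (e : Y ≅ Z) :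
    (C.units Y).map (Iso.conjAut e).toMonoidHom = C.units Z := by
  -- `Base` commutes with conjugation (Mathlib's `Functor.map_conjAut`, read in `Aut`)
  have key : ∀ {Y' Z' : C.category} (e' : Y' ≅ Z') (σ : Aut Y'),
      C.baseFunctorOfCategory.mapAut Z' (e'.conjAut σ) =
        (C.baseFunctorOfCategory.mapIso e').conjAut (C.baseFunctorOfCategory.mapAut Y' σ) :=
    fun e' σ => C.baseFunctorOfCategory.map_conjAut e' σ
  rw [units_eq_ker_autBase, units_eq_ker_autBase]
  ext τ
  constructor
  · rintro ⟨σ, hσ, rfl⟩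
    rw [SetLike.mem_coe, MonoidHom.mem_ker] at hσ
    rw [MonoidHom.mem_ker]
    change C.baseFunctorOfCategory.mapAut Z (e.conjAut σ) = 1
    rw [key, hσ, map_one]
  · intro hτ
    rw [MonoidHom.mem_ker] at hτ
    refine ⟨e.symm.conjAut τ, ?_, ?_⟩
    · rw [SetLike.mem_coe, MonoidHom.mem_ker, key, hτ, map_one]
    · change e.conjAut (e.symm.conjAut τ) = τ
      rw [← Iso.trans_conjAut, Iso.symm_self_id]
      exact Iso.ext (by rw [Iso.conjAut_hom, Iso.refl_conj])

/-- Elementwise: `e⁻¹ ∘ u ∘ e ∈ O^×(Z)` for `u ∈ O^×(Y)`. [cite: MochizukiFrdII2008, Def 2.2 (i) p.17] -/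
theorem conjAut_mem_units {Y Z : C.category} (e : Y ≅ Z) {u : Aut Y} (hu : u ∈ C.units Y) :
    e.conjAut u ∈ C.units Z := by
  rw [← C.units_map_conjAut e]
  exact Subgroup.mem_map_of_mem _ hu

end TemperedFrobenioid

end Literature.AnabelianGeometry.EtaleTheta
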